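import Literature.MathematicalPhysics.QuantumLattice.TorusShellCountLog
import HarnessLib

/-!
# The inverse-gap sum on the torus is `O(L² log²(1/e₀))`, uniformly in the level

Family `hubbard` / topic `MathematicalPhysics/QuantumLattice`; companion of `TorusInverseGapSum.lean`
(`sum_inv_abs_sub_le`: `Σ_{|ε-μ| ≥ e₀} 1/|ε-μ| ≤ 4L²/√e₀ + 4L/e₀`, uniform in `μ`) and of
`TorusInverseGapSumOffVanHove.lean` (`sum_inv_abs_sub_le_log`: `O(L² log(1/e₀)/√d₀)` for levels at
distance `≥ d₀` from the van Hove level and the band bottom). With the van-Hove-safe shell count of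
`TorusShellCountLog.lean` (`#{|ε - μ| < η} ≤ 6 η log(16/η) L² + 52 L` for `η ≤ 4`) the same 4-adic
layer cake gives the bound that is uniform in the level AND logarithmic:

* `sum_inv_abs_sub_le_log_sq`: for every `μ` and `0 < e₀ ≤ 1`,
  `Σ_{k : |ε_L(k) - μ| ≥ e₀} 1/|ε_L(k) - μ| ≤ 20·L²·log²(4/e₀) + 70·L/e₀`.

Proof: shells `e₀4^j ≤ |ε - μ| < e₀4^{j+1}` up to the first `J` with `e₀4^J ≥ 1` (`J log 4 ≤
log(4/e₀)` shells, each contributing `24 log(4/e₀) L² + 52 L/(e₀4^j)`), and the tail `|ε - μ| ≥ e₀4^J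
≥ 1` at most `L²`. The square of the logarithm is the van Hove density of states integrated against
`1/|ξ|`: this is the `Σ_k 1/|ξ_k| = O(L² log²)` of the BCS gap equation AT the van Hove filling
(where it enhances pairing), and an upper bound at every filling. Consumer: the filling-uniform
pairing-cost rate `a/log²(1/a)` (`FreeFermiGasPairingCostUniform.lean`).

Sources: J. Bardeen, L. N. Cooper, J. R. Schrieffer, Phys. Rev. 108 (1957) 1175, §II (the pairing
logarithm); L. Van Hove, Phys. Rev. 89 (1953) 1189; folklore lattice-point counting. No named facts,
no definitions.

## Mathlib / tree search

Tree: `card_torusShell_lt_le_log'`, `log_four_ge` (`TorusShellCountLog`), `sum_inv_abs_sub_le`,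
`sum_inv_abs_sub_le_log`, `card_torusSite`. Mathlib: `Nat.find`, `Nat.find_spec`, `Nat.find_min'`,
`pow_unbounded_of_one_lt`, `exists_nat_pow_near`, `Finset.sum_ite_mem`, `Finset.single_le_sum`,
`Finset.sum_comm`, `geom_sum_Ico_le_of_lt_one`, `Real.log_le_log`, `Real.log_pow`.
-/

noncomputable section

namespace Literature.MathematicalPhysics.QuantumLattice

open Real Finset Literature.Probability.LatticeModels

section InverseGapLog

variable {L : ℕ} [NeZero L]

/-- **Inverse-gap sum on the torus, uniform logarithmic form.** For every level `μ` and window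
`0 < e₀ ≤ 1`: `Σ_{k : |ε_L(k) - μ| ≥ e₀} 1/|ε_L(k) - μ| ≤ 20·L²·log²(4/e₀) + 70·L/e₀` (4-adic layer
cake on the shells `e₀4^j ≤ |ε - μ| < e₀4^{j+1}`, `j < J`, `J` least with `e₀ 4^J ≥ 1`, with the
van-Hove-safe count `#{|ε - μ| < η} ≤ 6η log(16/η)L² + 52L`, `η = e₀4^{j+1} ≤ 4`; the tail
`|ε - μ| ≥ 1` contributes at most `L²`; `J log 4 ≤ log(4/e₀)`). Uniform in `μ`, including the van
Hove level, where the order `L² log²(1/e₀)` is attained. [folklore] -/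
theorem sum_inv_abs_sub_le_log_sq (μ : ℝ) {e₀ : ℝ} (he : 0 < e₀) (he1 : e₀ ≤ 1) :
    ∑ k ∈ Finset.univ.filter (fun k : TorusSite 2 L => e₀ ≤ |torusBand L k - μ|),
        1 / |torusBand L k - μ| ≤
      20 * (L : ℝ) ^ 2 * Real.log (4 / e₀) ^ 2 + 70 * L / e₀ := by
  classical
  -- the number of shells
  have hex : ∃ J : ℕ, 1 ≤ e₀ * 4 ^ J := by
    obtain ⟨J, hJ⟩ := pow_unbounded_of_one_lt (1 / e₀) (by norm_num : (1 : ℝ) < 4)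
    refine ⟨J, ?_⟩
    rw [div_lt_iff₀ he] at hJ
    linarith
  set J : ℕ := Nat.find hex with hJdef
  have hJspec : 1 ≤ e₀ * 4 ^ J := Nat.find_spec hex
  have hJmin : ∀ j : ℕ, j < J → e₀ * 4 ^ j < 1 := fun j hj => by
    have := Nat.find_min hex (by rw [← hJdef]; exact hj)
    push Not at this
    exact this
  set Λ : ℝ := Real.log (4 / e₀) with hΛ
  have hlog4 := log_four_ge
  have hl0 : 0 < Real.log 4 := by linarith
  have hΛ4 : Real.log 4 ≤ Λ := by
    refine Real.log_le_log (by norm_num) ?_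
    rw [le_div_iff₀ he]; nlinarith
  have hΛ0 : 0 ≤ Λ := hl0.le.trans hΛ4
  -- `J log 4 ≤ Λ`
  have hJΛ : (J : ℝ) * Real.log 4 ≤ Λ := by
    rcases Nat.eq_zero_or_pos J with hJ0 | hJpos
    · rw [hJ0]; simp [hΛ0]
    · have hlt := hJmin (J - 1) (by omega)
      -- `4^(J-1) < 1/e₀`, so `4^J < 4/e₀`
      have h4 : (4 : ℝ) ^ J < 4 / e₀ := by
        have e : (4 : ℝ) ^ J = 4 * 4 ^ (J - 1) := by
          rw [← pow_succ']; congr 1; omega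
        rw [e, lt_div_iff₀ he]
        nlinarith
      have := Real.log_le_log (by positivity) h4.le
      rwa [Real.log_pow] at this
  set A : ℕ → Finset (TorusSite 2 L) := fun j => Finset.univ.filter fun k : TorusSite 2 L =>
      e₀ * 4 ^ j ≤ |torusBand L k - μ| ∧ |torusBand L k - μ| < e₀ * 4 ^ (j + 1) with hA
  set T : Finset (TorusSite 2 L) := Finset.univ.filter fun k : TorusSite 2 L =>
      e₀ * 4 ^ J ≤ |torusBand L k - μ| with hT
  have hL0 : (0 : ℝ) ≤ L := Nat.cast_nonneg _
  have hLpos : (0 : ℝ) < L := Nat.cast_pos.2 (Nat.pos_of_ne_zero (NeZero.ne L))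
  -- pointwise layer cake
  have hpt : ∀ k : TorusSite 2 L, e₀ ≤ |torusBand L k - μ| →
      1 / |torusBand L k - μ| ≤
        ∑ j ∈ Finset.range J, (if k ∈ A j then 1 / (e₀ * 4 ^ j) else 0) +
          (if k ∈ T then 1 else 0) := by
    intro k hk
    have hξ : 0 < |torusBand L k - μ| := lt_of_lt_of_le he hk
    have hterm0 : ∀ j ∈ Finset.range J, (0 : ℝ) ≤ if k ∈ A j then 1 / (e₀ * 4 ^ j) else 0 := by
      intro j _
      split_ifs <;> positivity
    have htail0 : (0 : ℝ) ≤ if k ∈ T then 1 else 0 := by split_ifs <;> norm_num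
    by_cases hkT : k ∈ T
    · rw [if_pos hkT]
      have hge : e₀ * 4 ^ J ≤ |torusBand L k - μ| := (Finset.mem_filter.1 hkT).2
      have hle : 1 / |torusBand L k - μ| ≤ 1 := by
        rw [div_le_iff₀ hξ]; linarith
      have := Finset.sum_nonneg hterm0
      linarith
    · have hlt : |torusBand L k - μ| < e₀ * 4 ^ J := by
        by_contra h'
        push Not at h'
        exact hkT (by simp only [hT, Finset.mem_filter, Finset.mem_univ, true_and]; exact h')
      rw [if_neg hkT, add_zero]
      obtain ⟨j, hj1, hj2⟩ := exists_nat_pow_near (x := |torusBand L k - μ| / e₀) (y := (4 : ℝ))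
        (by rwa [le_div_iff₀ he, one_mul]) (by norm_num)
      rw [le_div_iff₀ he] at hj1
      rw [div_lt_iff₀ he] at hj2
      have hjJ : j < J := by
        by_contra h'
        push Not at h'
        have : (e₀ * 4 ^ J : ℝ) ≤ e₀ * 4 ^ j :=
          mul_le_mul_of_nonneg_left (pow_le_pow_right₀ (by norm_num) h') he.le
        linarith
      have hkA : k ∈ A j := by
        simp only [hA, Finset.mem_filter, Finset.mem_univ, true_and]
        exact ⟨by linarith, by linarith⟩
      have hle : 1 / |torusBand L k - μ| ≤ 1 / (e₀ * 4 ^ j) :=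
        one_div_le_one_div_of_le (by positivity) (by linarith)
      have hsingle : (if k ∈ A j then 1 / (e₀ * 4 ^ j) else 0 : ℝ) ≤
          ∑ j ∈ Finset.range J, (if k ∈ A j then 1 / (e₀ * 4 ^ j) else 0) :=
        Finset.single_le_sum hterm0 (Finset.mem_range.2 hjJ)
      rw [if_pos hkA] at hsingle
      linarith
  -- shell counts: `|A j| ≤ 24 Λ L² · (e₀4^j) ... ` in the form `|A j| / (e₀ 4^j) ≤ 24 Λ L² + 52 L/(e₀4^j)`
  have hA_card : ∀ j, j < J → ((A j).card : ℝ) ≤ 24 * (e₀ * 4 ^ j) * Λ * (L : ℝ) ^ 2 + 52 * L := by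
    intro j hj
    have hsub : A j ⊆ Finset.univ.filter
        (fun k : TorusSite 2 L => |torusBand L k - μ| < e₀ * 4 ^ (j + 1)) := by
      intro k hk
      simp only [hA, Finset.mem_filter] at hk ⊢
      exact ⟨hk.1, hk.2.2⟩
    have h1 : ((A j).card : ℝ) ≤ ((Finset.univ.filter
        (fun k : TorusSite 2 L => |torusBand L k - μ| < e₀ * 4 ^ (j + 1))).card : ℝ) := by
      exact_mod_cast Finset.card_le_card hsub
    have hη0 : 0 < e₀ * 4 ^ (j + 1) := by positivity
    have hη4 : e₀ * 4 ^ (j + 1) ≤ 4 := by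
      have := hJmin j hj
      rw [pow_succ]; nlinarith
    have h2 := card_torusShell_lt_le_log' (L := L) hη0 hη4 μ
    -- `log(16/(e₀4^(j+1))) = log(4/(e₀ 4^j)) ≤ Λ`
    have hlog : Real.log (16 / (e₀ * 4 ^ (j + 1))) ≤ Λ := by
      refine Real.log_le_log (by positivity) ?_
      rw [div_le_div_iff₀ hη0 he]
      have h4j : (1 : ℝ) ≤ 4 ^ j := one_le_pow₀ (by norm_num)
      have : 16 * e₀ ≤ 4 * (e₀ * 4 ^ (j + 1)) := by rw [pow_succ]; nlinarith
      linarith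
    have h3 : 6 * (e₀ * 4 ^ (j + 1)) * Real.log (16 / (e₀ * 4 ^ (j + 1))) * (L : ℝ) ^ 2 ≤
        24 * (e₀ * 4 ^ j) * Λ * (L : ℝ) ^ 2 := by
      have e : 6 * (e₀ * 4 ^ (j + 1)) = 24 * (e₀ * 4 ^ j) := by rw [pow_succ]; ring
      rw [e]
      have h0 : 0 ≤ 24 * (e₀ * 4 ^ j) * (L : ℝ) ^ 2 := by positivity
      have := mul_le_mul_of_nonneg_left hlog h0
      calc 24 * (e₀ * 4 ^ j) * Real.log (16 / (e₀ * 4 ^ (j + 1))) * (L : ℝ) ^ 2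
          = 24 * (e₀ * 4 ^ j) * (L : ℝ) ^ 2 * Real.log (16 / (e₀ * 4 ^ (j + 1))) := by ring
        _ ≤ 24 * (e₀ * 4 ^ j) * (L : ℝ) ^ 2 * Λ := this
        _ = 24 * (e₀ * 4 ^ j) * Λ * (L : ℝ) ^ 2 := by ring
    linarith
  have hT_card : ((T.card : ℕ) : ℝ) ≤ (L : ℝ) ^ 2 := by
    have := Finset.card_le_univ T
    rw [card_torusSite] at this
    exact_mod_cast this
  -- sum the pointwise bound
  calc ∑ k ∈ Finset.univ.filter (fun k : TorusSite 2 L => e₀ ≤ |torusBand L k - μ|),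
        1 / |torusBand L k - μ|
      ≤ ∑ k ∈ Finset.univ.filter (fun k : TorusSite 2 L => e₀ ≤ |torusBand L k - μ|),
          (∑ j ∈ Finset.range J, (if k ∈ A j then 1 / (e₀ * 4 ^ j) else 0) +
            (if k ∈ T then 1 else 0)) :=
        Finset.sum_le_sum fun k hk => hpt k (Finset.mem_filter.1 hk).2
    _ ≤ ∑ k, (∑ j ∈ Finset.range J, (if k ∈ A j then 1 / (e₀ * 4 ^ j) else 0) +
            (if k ∈ T then 1 else 0)) := by
        apply Finset.sum_le_sum_of_subset_of_nonneg (Finset.filter_subset _ _)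
        intro k _ _
        refine add_nonneg (Finset.sum_nonneg fun j _ => ?_) ?_
        · split_ifs <;> positivity
        · split_ifs <;> norm_num
    _ = ∑ j ∈ Finset.range J, ((A j).card : ℝ) * (1 / (e₀ * 4 ^ j)) + (T.card : ℝ) * 1 := by
        rw [Finset.sum_add_distrib, Finset.sum_comm]
        congr 1
        · refine Finset.sum_congr rfl fun j _ => ?_
          rw [Finset.sum_ite_mem, Finset.univ_inter, Finset.sum_const, nsmul_eq_mul]
        · rw [Finset.sum_ite_mem, Finset.univ_inter, Finset.sum_const, nsmul_eq_mul]
    _ ≤ ∑ j ∈ Finset.range J, (24 * Λ * (L : ℝ) ^ 2 + 52 * L / e₀ * (1 / 4 : ℝ) ^ j) + (L : ℝ) ^ 2 := by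
        refine add_le_add (Finset.sum_le_sum fun j hj => ?_) (by rw [mul_one]; exact hT_card)
        have hjJ : j < J := Finset.mem_range.1 hj
        have hpos : (0 : ℝ) < e₀ * 4 ^ j := by positivity
        have h := mul_le_mul_of_nonneg_right (hA_card j hjJ) (show (0 : ℝ) ≤ 1 / (e₀ * 4 ^ j) by positivity)
        refine h.trans (le_of_eq ?_)
        rw [_root_.one_div_pow]
        field_simp
    _ = 24 * Λ * (L : ℝ) ^ 2 * J + 52 * L / e₀ * ∑ j ∈ Finset.range J, (1 / 4 : ℝ) ^ j + (L : ℝ) ^ 2 := by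
        rw [Finset.sum_add_distrib, Finset.sum_const, Finset.card_range, nsmul_eq_mul, ← Finset.mul_sum]
        ring
    _ ≤ 24 * Λ * (L : ℝ) ^ 2 * J + 52 * L / e₀ * (4 / 3) + (L : ℝ) ^ 2 := by
        have hg4 : ∑ j ∈ Finset.range J, (1 / 4 : ℝ) ^ j ≤ 4 / 3 := by
          have := geom_sum_Ico_le_of_lt_one (x := (1 / 4 : ℝ)) (m := 0) (n := J)
            (by norm_num) (by norm_num)
          rw [Finset.range_eq_Ico]
          refine this.trans ?_
          norm_num
        have hb : 0 ≤ 52 * (L : ℝ) / e₀ := by positivity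
        linarith [mul_le_mul_of_nonneg_left hg4 hb]
    _ ≤ 20 * (L : ℝ) ^ 2 * Λ ^ 2 + 70 * L / e₀ := by
        -- `24 Λ J + 1 ≤ 20 Λ²` from `J log 4 ≤ Λ`, `Λ ≥ log 4 ≥ 1.3862`
        have hL2 : 0 ≤ (L : ℝ) ^ 2 := sq_nonneg _
        have hJ' : 24 * Λ * (J : ℝ) ≤ 24 * Λ * (Λ / Real.log 4) := by
          refine mul_le_mul_of_nonneg_left ?_ (by positivity)
          rw [le_div_iff₀ hl0]; exact hJΛ
        have hkey : 24 * Λ * (Λ / Real.log 4) + 1 ≤ 20 * Λ ^ 2 := by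
          -- `24/log 4 ≤ 17.32` and `1 ≤ 2.68·log²4 ≤ 2.68 Λ²`
          have h24 : 24 * Λ * (Λ / Real.log 4) = (24 / Real.log 4) * Λ ^ 2 := by
            field_simp
          rw [h24]
          have hc : 24 / Real.log 4 ≤ 17.32 := by
            rw [div_le_iff₀ hl0]; nlinarith
          have hΛ2 : Real.log 4 ^ 2 ≤ Λ ^ 2 := pow_le_pow_left₀ hl0.le hΛ4 2
          have hl2 : (1.3862 : ℝ) ^ 2 ≤ Real.log 4 ^ 2 := pow_le_pow_left₀ (by norm_num) hlog4 2
          nlinarith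
        have h1 : 24 * Λ * (L : ℝ) ^ 2 * J + (L : ℝ) ^ 2 = (24 * Λ * J + 1) * (L : ℝ) ^ 2 := by ring
        have h2 : (24 * Λ * (J : ℝ) + 1) * (L : ℝ) ^ 2 ≤ (20 * Λ ^ 2) * (L : ℝ) ^ 2 :=
          mul_le_mul_of_nonneg_right (by linarith) hL2
        have h3 : 52 * (L : ℝ) / e₀ * (4 / 3) ≤ 70 * L / e₀ := by
          rw [div_mul_eq_mul_div, div_le_div_iff_of_pos_right he]
          nlinarith
        nlinarith

end InverseGapLog

end Literature.MathematicalPhysics.QuantumLattice
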